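import Mathlib

/-!
# StrengthenTowerCollapse — kernel checks for MEMO-07 v1.4 §2quater (plan-lens-HodgeAV-strengthen g4)

TOWER COLLAPSE (census-neutral; letter ∕ integer model only; nothing here is proved toward HC / HC_CM / HC_AV /
№ 4 / 26512 / 18881 / H2).  After the top shift σ^{-(h-12)/2} every height-h LINE letter becomes a letter of the single
extended height-12 alphabet `ℓ R u = (12 − 2R, R·u)` (depth `R : ℕ`, phase `u ∈ {1, −1, i, −i}`), and the model-of-record
Hom-liveness `psd Δ := Δ = 0 ∨ (Δa > 0 ∧ Δa² ≥ Δx² + Δy²)` depends on letter DIFFERENCES only, hence is height-free.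
This file proves the exact live-cone thresholds of the deepest letter against the rest, used in §2quater (Q4):
* same phase: `Hom(ℓ_R → ℓ_r)` is live for every `r < R`;
* opposite phase: live iff `3 r ≤ R`;
* orthogonal phase: live iff `8 R r ≤ 3 R² + 3 r²` (i.e. `r ≤ (4 − √7)/3 · R ≈ 0.451 R`).
-/

set_option linter.dupNamespace false

namespace Summit.HodgeConjecture.HodgeConjecture.Cruxes.BlochSeedDiscOne.StrengthenTowerCollapse

/-- Block positivity of a letter difference (padclass `psd`, the model of record). -/
def psd (Δa Δx Δy : ℤ) : Prop := (Δa = 0 ∧ Δx = 0 ∧ Δy = 0) ∨ (0 < Δa ∧ Δx ^ 2 + Δy ^ 2 ≤ Δa ^ 2)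

/-- The extended LINE letter of depth `R` with real phase `ε ∈ {1,−1}`: (top, x, y) = (12 − 2R, εR, 0). -/
def lineRe (R ε : ℤ) : ℤ × ℤ × ℤ := (12 - 2 * R, ε * R, 0)
/-- The extended LINE letter of depth `R` with imaginary phase `ε i`: (12 − 2R, 0, εR). -/
def lineIm (R ε : ℤ) : ℤ × ℤ × ℤ := (12 - 2 * R, 0, ε * R)

/-- Hom-liveness from letter `p` (lower) to letter `q` (upper): `q − p` is psd. -/
def live (p q : ℤ × ℤ × ℤ) : Prop := psd (q.1 - p.1) (q.2.1 - p.2.1) (q.2.2 - p.2.2)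

/-- Same phase: the deepest letter maps to every shallower letter. -/
theorem live_same_phase (R r : ℤ) (h : r < R) : live (lineRe R 1) (lineRe r 1) := by
  unfold live psd lineRe
  right
  refine ⟨by simp; omega, ?_⟩
  simp only
  nlinarith [h]

/-- Opposite phase: live iff `3 r ≤ R` (for `0 ≤ r < R`). -/
theorem live_opposite_phase_iff (R r : ℤ) (hr : 0 ≤ r) (h : r < R) :
    live (lineRe R 1) (lineRe r (-1)) ↔ 3 * r ≤ R := by
  unfold live psd lineRe
  simp only
  constructor
  · rintro (⟨h0, -, -⟩ | ⟨-, h2⟩)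
    · omega
    · nlinarith [h2, hr, h]
  · intro h3
    right
    exact ⟨by omega, by nlinarith [h3, hr, h]⟩

/-- Orthogonal phase: live iff `8 R r ≤ 3 R² + 3 r²` (for `r < R`; i.e. `r ≤ (4 − √7)/3 · R` when `0 ≤ r`). -/
theorem live_orthogonal_phase_iff (R r : ℤ) (h : r < R) :
    live (lineRe R 1) (lineIm r 1) ↔ 8 * R * r ≤ 3 * R ^ 2 + 3 * r ^ 2 := by
  unfold live psd lineRe lineIm
  simp only
  constructor
  · rintro (⟨h0, -, -⟩ | ⟨-, h2⟩)
    · omega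
    · nlinarith [h2, h]
  · intro h3
    right
    exact ⟨by omega, by nlinarith [h3, h]⟩

/-- The orthogonal threshold is the cone `r ≤ (4 − √7)/3 · R`: e.g. at R = 30 the live partners are exactly r ≤ 13. -/
theorem orthogonal_threshold_R30 : (8 * 30 * 13 ≤ 3 * 30 ^ 2 + 3 * 13 ^ 2) ∧ ¬ (8 * 30 * 14 ≤ 3 * 30 ^ 2 + 3 * 14 ^ 2) := by
  norm_num

/-- The live relation is a homogeneous cone condition: scaling both depths preserves it (self-similarity of the step). -/
theorem live_orthogonal_scale (R r k : ℤ) (hk : 0 < k) :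
    (8 * (k * R) * (k * r) ≤ 3 * (k * R) ^ 2 + 3 * (k * r) ^ 2) ↔ (8 * R * r ≤ 3 * R ^ 2 + 3 * r ^ 2) := by
  constructor
  · intro h1
    have hk2 : 0 < k ^ 2 := by positivity
    nlinarith [h1, hk2]
  · intro h1
    have hk2 : 0 < k ^ 2 := by positivity
    nlinarith [h1, hk2]

end Summit.HodgeConjecture.HodgeConjecture.Cruxes.BlochSeedDiscOne.StrengthenTowerCollapse
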